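import Mathlib
import Summits.Ventures.PercRepro2.Defs
import Summits.Ventures.PercRepro2.Independence
import Summits.Ventures.PercRepro2.Harris
import Summits.Ventures.PercRepro2.Graph
import Summits.Ventures.PercRepro2.Exploration
import Summits.Ventures.PercRepro2.Events
import Summits.Ventures.PercRepro2.Statements
import Summits.Ventures.PercRepro2.FourFunctions
import Summits.Ventures.PercRepro2.Induced
import Summits.Ventures.PercRepro2.Frontier
import Summits.Ventures.PercRepro2.ObsIndependence
import Summits.Ventures.PercRepro2.BHK
import Summits.Ventures.PercRepro2.BHKEvents
import Summits.Ventures.PercRepro2.ClusterProperty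
import Summits.Ventures.PercRepro2.BHKPair
import Summits.Ventures.PercRepro2.CondAvoidPA
import Summits.Ventures.PercRepro2.CondAvoidZPA
import Summits.Ventures.PercRepro2.BoxUnionDefs
import Summits.Ventures.PercRepro2.BoxUnion
import Summits.Ventures.PercRepro2.BoxUnionPair
import Summits.Ventures.PercRepro2.PairTP2
import Summits.Ventures.PercRepro2.PairTP2Main
import Summits.Ventures.PercRepro2.UnionRowMech
import Summits.Ventures.PercRepro2.UnionRowMech2
import Summits.Ventures.PercRepro2.UnionRowBilinear
import Summits.Ventures.PercRepro2.UnionRowGrid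
import Summits.Ventures.PercRepro2.UnionRowGrid2
import Summits.Ventures.PercRepro2.UnionRowCellDefs
import Summits.Ventures.PercRepro2.UnionRowCell

/-!
# The two-status union row for ALL (Z)-increasing observables, on every graph
(blind cell PercRepro2, mine-1 g39; proofs/MINE1-UNIONROW2.md §1 (R2), §7)

A (Z)-increasing observable `f : Finset V → Finset V → ℝ` of the two statuses induces a monotone
function `gridFun f` on the status grid (`iota` is monotone), and the union row in the cell's form
equals `Z⁻²·rowVal M U_XY (gridFun f) (gridFun g)` (`row_eq_rowVal`). The bilinear reduction
(`UnionRowMech.rowVal_nonneg_of_upsets`) brings this back to up-set indicators, for which the row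
over the union cells is nonnegative whenever the union event keeps at least one of the two
double-hit cells (`sum_term_unionCells_nonneg'`). Hence:

**THEOREM** (`union_row_nonneg_general`): for `u ≠ v`, every finite graph, every admissible
weight vector with `P(s ↮ t) > 0`, all `X, Y ⊆ {u, v}` whose union event does not cut BOTH
double-hit cells, and ALL `f, g` increasing in `C_s` and decreasing in `C_t`,
`E[(f(σ) − E[f(σ) | Q]) (g(σ) − E[g(σ) | Q]) · 1_{Q ∩ ({s ↮ X} ∪ {t ↮ Y})}] ≥ 0` —
row 2′CON-U for two-status observables, exactly the statement of
`PairTP2.hit_boxUnion_nonneg_of_pairTP2` without its (PAIR-TP2) hypothesis (and without any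
log-supermodularity), for every union type but the double exclusion.
-/

namespace Summit.Ventures.PercRepro2

namespace UnionRowCell

open Finset UnionRowMech UnionRowGrid
open scoped Classical

variable {V : Type*} {E : Type*} [Fintype V] [DecidableEq V] [Fintype E] [DecidableEq E]
variable (ends : E → Sym2 V) (s t u v : V) {p : E → ℝ}

/-! ### Grid functions of (Z)-increasing observables -/

/-- The grid function of an observable of the two statuses. -/
noncomputable def gridFun (f : Finset V → Finset V → ℝ) : Grid → ℝ :=
  fun k => f (PairTP2.iota u v k).1 (OrderDual.ofDual (PairTP2.iota u v k).2)

omit [Fintype V] [DecidableEq V] [Fintype E] [DecidableEq E] in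
/-- `2` is the top of `Fin 3`. -/
lemma fin3_eq_two_of_le : ∀ a b : Fin 3, a = 2 → a ≤ b → b = 2 := by decide

omit [Fintype V] [DecidableEq V] [Fintype E] [DecidableEq E] in
/-- `0` is the bottom of `Fin 3`. -/
lemma fin3_eq_zero_of_le : ∀ a b : Fin 3, b = 0 → a ≤ b → a = 0 := by decide

omit [Fintype V] [Fintype E] [DecidableEq E] in
/-- `iota` is increasing in the first coordinate. -/
lemma iota_mono_fst {k k' : Grid} (h : k ≤ k') :
    (PairTP2.iota u v k).1 ⊆ (PairTP2.iota u v k').1 := by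
  intro x hx
  rw [PairTP2.mem_iota_fst] at hx ⊢
  rcases hx with ⟨hxu, h2⟩ | ⟨hxv, h2⟩
  · exact Or.inl ⟨hxu, fin3_eq_two_of_le _ _ h2 h.1⟩
  · exact Or.inr ⟨hxv, fin3_eq_two_of_le _ _ h2 h.2⟩

omit [Fintype V] [Fintype E] [DecidableEq E] in
/-- `iota` is decreasing in the second coordinate. -/
lemma iota_anti_snd {k k' : Grid} (h : k ≤ k') :
    OrderDual.ofDual (PairTP2.iota u v k').2 ⊆ OrderDual.ofDual (PairTP2.iota u v k).2 := by
  intro x hx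
  rw [PairTP2.mem_iota_snd] at hx ⊢
  rcases hx with ⟨hxu, h0⟩ | ⟨hxv, h0⟩
  · exact Or.inl ⟨hxu, fin3_eq_zero_of_le _ _ h0 h.1⟩
  · exact Or.inr ⟨hxv, fin3_eq_zero_of_le _ _ h0 h.2⟩

omit [Fintype V] [Fintype E] [DecidableEq E] in
/-- The grid function of a (Z)-increasing observable is monotone. -/
lemma gridFun_mono {f : Finset V → Finset V → ℝ}
    (hf : ∀ ⦃W W' C C' : Finset V⦄, W ⊆ W' → C' ⊆ C → f W C ≤ f W' C') :
    Monotone (gridFun u v f) :=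
  fun _ _ h => hf (iota_mono_fst u v h) (iota_anti_snd u v h)

/-! ### The conditional mean and the identification -/

/-- The conditional mean of an observable is `Σ M·gridFun / Z`. -/
lemma condMean_eq (hne : u ≠ v) (f : Finset V → Finset V → ℝ) :
    BoxUnionPair.condMean p ends {u, v} s t (fun k => f k.1 (OrderDual.ofDual k.2)) =
      (∑ j, gridMass ends s t u v p j * gridFun u v f j) / total (gridMass ends s t u v p) := by
  rw [← BoxUnionPair.mean_pairLaw]
  unfold BoxUnion.mean
  rw [sum_pairLaw_eq_grid ends s t u v hne, BoxUnionPair.sum_pairLaw, ← total_gridMass_eq]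
  rfl

/-- **Identification**: the union row in the cell's form is `Z⁻²` times the `Z²`-scaled grid
row over the union cells. -/
theorem row_eq_rowVal (hne : u ≠ v) (f g : Finset V → Finset V → ℝ) {X Y : Finset V}
    (hX : X ⊆ {u, v}) (hY : Y ⊆ {u, v}) (hZ : total (gridMass ends s t u v p) ≠ 0) :
    expect p (((connEvent ends s t)ᶜ ∩ ((hitEvent ends s X)ᶜ ∪ (hitEvent ends t Y)ᶜ)).indicator
      (fun ω =>
        (f (BoxUnionPair.status ends {u, v} s t ω).1
              (OrderDual.ofDual (BoxUnionPair.status ends {u, v} s t ω).2) -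
            BoxUnionPair.condMean p ends {u, v} s t
              (fun k => f k.1 (OrderDual.ofDual k.2))) *
          (g (BoxUnionPair.status ends {u, v} s t ω).1
              (OrderDual.ofDual (BoxUnionPair.status ends {u, v} s t ω).2) -
            BoxUnionPair.condMean p ends {u, v} s t
              (fun k => g k.1 (OrderDual.ofDual k.2))))) =
      rowVal (gridMass ends s t u v p) (unionCells u v X Y) (gridFun u v f) (gridFun u v g) /
        total (gridMass ends s t u v p) ^ 2 := by
  set cA := BoxUnionPair.condMean p ends {u, v} s t
    (fun k => f k.1 (OrderDual.ofDual k.2)) with hcA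
  set cB := BoxUnionPair.condMean p ends {u, v} s t
    (fun k => g k.1 (OrderDual.ofDual k.2)) with hcB
  set φ : BoxUnionPair.ZLat V → ℝ := fun k =>
    (f k.1 (OrderDual.ofDual k.2) - cA) * (g k.1 (OrderDual.ofDual k.2) - cB) with hφ
  set S : Set (Config E) :=
    (connEvent ends s t)ᶜ ∩ ((hitEvent ends s X)ᶜ ∪ (hitEvent ends t Y)ᶜ) with hS
  have h12 : expect p (S.indicator (fun ω => φ (BoxUnionPair.status ends {u, v} s t ω))) =
      ∑ k, BoxUnionPair.pairLaw p ends {u, v} s t k *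
        (if (k.1 ∩ X = ∅ ∨ OrderDual.ofDual k.2 ∩ Y = ∅) then φ k else 0) := by
    rw [BoxUnionPair.sum_pairLaw_mul]
    unfold expect
    refine Finset.sum_congr rfl fun ω _ => ?_
    have hmem : (ω ∈ (connEvent ends s t)ᶜ ∧
        ((BoxUnionPair.status ends {u, v} s t ω).1 ∩ X = ∅ ∨
          OrderDual.ofDual (BoxUnionPair.status ends {u, v} s t ω).2 ∩ Y = ∅)) ↔ ω ∈ S := by
      rw [BoxUnionPair.status_fst_inter_eq_empty_iff ends {u, v} s t hX,
        BoxUnionPair.status_snd_inter_eq_empty_iff ends {u, v} s t hY]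
      simp only [hS, Set.mem_inter_iff, Set.mem_union, Set.mem_compl_iff]
    by_cases hQ : ω ∈ (connEvent ends s t)ᶜ
    · by_cases hU : (BoxUnionPair.status ends {u, v} s t ω).1 ∩ X = ∅ ∨
          OrderDual.ofDual (BoxUnionPair.status ends {u, v} s t ω).2 ∩ Y = ∅
      · rw [if_pos hQ, if_pos hU, Set.indicator_of_mem (hmem.1 ⟨hQ, hU⟩)]
      · rw [if_pos hQ, if_neg hU, Set.indicator_of_notMem (fun h => hU (hmem.2 h).2), mul_zero]
    · rw [if_neg hQ, Set.indicator_of_notMem (fun h => hQ (hmem.2 h).1), mul_zero]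
  rw [h12, sum_pairLaw_eq_grid ends s t u v hne]
  unfold rowVal unionCells
  rw [Finset.sum_div, Finset.sum_filter]
  refine Finset.sum_congr rfl fun k _ => ?_
  have hk := mem_boxUnion_iota u v hne X Y k
  simp only [unionCells, Finset.mem_filter, Finset.mem_univ, true_and] at hk
  by_cases hU : ((u ∈ X → k.1 ≠ 2) ∧ (v ∈ X → k.2 ≠ 2)) ∨ ((u ∈ Y → k.1 ≠ 0) ∧ (v ∈ Y → k.2 ≠ 0))
  · rw [if_pos (hk.2 hU), if_pos hU]
    simp only [hφ, hcA, hcB, condMean_eq ends s t u v hne, centred, gridFun]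
    field_simp
  · rw [if_neg (fun h => hU (hk.1 h)), if_neg hU, mul_zero]

/-! ### The up-set case over the union cells, restated -/

/-- `rowVal` on up-set indicators is the sum of the terms. -/
lemma rowVal_ind_eq (M : Grid → ℝ) (U A B : Finset Grid) :
    rowVal M U (ind A) (ind B) = ∑ k ∈ U, term M A B k := by
  unfold rowVal term centred ind
  have hm : ∀ C : Finset Grid, ∑ j, M j * (if j ∈ C then (1 : ℝ) else 0) = mass M C := by
    intro C
    unfold mass
    simp_rw [mul_ite, mul_one, mul_zero]
    rw [← Finset.sum_filter, Finset.filter_mem_eq_inter, Finset.univ_inter]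
  simp_rw [hm]

/-- The sum of the terms over the union cells is nonnegative when the union event keeps at least
one double-hit cell. -/
lemma sum_term_unionCells_nonneg' (hp : IsProbVec p) {X Y : Finset V}
    (hU : UnionRowMech.ST ∈ unionCells u v X Y ∨ TS ∈ unionCells u v X Y) {A B : Finset Grid}
    (hA : IsUp A) (hB : IsUp B) :
    0 ≤ ∑ k ∈ unionCells u v X Y, term (gridMass ends s t u v p) A B k := by
  rw [sum_term_unionCells, sum_term_univ]
  have hZ := total_nonneg (gridMass_nonneg ends s t u v hp)
  have hM0 := gridMass_nonneg ends s t u v hp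
  by_cases h1 : UnionRowMech.ST ∈ unionCells u v X Y <;>
    by_cases h2 : TS ∈ unionCells u v X Y
  · rw [if_pos h1, if_pos h2, sub_zero, sub_zero]
    have := pa_Q ends s t u v hp A B hA hB
    exact mul_nonneg hZ (by nlinarith)
  · rw [if_pos h1, if_neg h2, sub_zero]
    have := single_exclusion_generic hM0 (fun A hA h => up_subset_Ru hA h)
      (fun A hA h => down_subset_Rv' hA h) TS_notMem_Ru TS_notMem_Rv'
      (fun A B hA hB => pa_Q ends s t u v hp A B hA hB)
      (fun A B hA hB hAR hBR => pa_Ru ends s t u v hp A B hA hB hAR hBR)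
      (fun A B hA hB hAR hBR => pa_Rv' ends s t u v hp A B hA hB hAR hBR) hA hB
    unfold term
    exact this
  · rw [if_neg h1, if_pos h2, sub_zero]
    have := single_exclusion_row ends s t u v hp hA hB
    unfold term
    exact this
  · exact absurd hU (by tauto)

/-! ### The theorem -/

/-- **The two-status union row for all (Z)-increasing observables, on every graph**: for
`u ≠ v`, every admissible weight vector with `P(s ↮ t) > 0`, all `X, Y ⊆ {u, v}` whose union
event keeps at least one double-hit cell, and all `f, g` increasing in `C_s` and decreasing in
`C_t`, `E[(f(σ) − E[f(σ) | Q]) (g(σ) − E[g(σ) | Q]) · 1_{Q ∩ ({s ↮ X} ∪ {t ↮ Y})}] ≥ 0`. -/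
theorem union_row_nonneg_general (hne : u ≠ v) (hp : IsProbVec p)
    (hQ : 0 < prob p (connEvent ends s t)ᶜ) {X Y : Finset V} (hX : X ⊆ {u, v})
    (hY : Y ⊆ {u, v}) (hU : UnionRowMech.ST ∈ unionCells u v X Y ∨ TS ∈ unionCells u v X Y)
    {f g : Finset V → Finset V → ℝ}
    (hf : ∀ ⦃W W' C C' : Finset V⦄, W ⊆ W' → C' ⊆ C → f W C ≤ f W' C')
    (hg : ∀ ⦃W W' C C' : Finset V⦄, W ⊆ W' → C' ⊆ C → g W C ≤ g W' C') :
    0 ≤ expect p (((connEvent ends s t)ᶜ ∩ ((hitEvent ends s X)ᶜ ∪ (hitEvent ends t Y)ᶜ)).indicator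
      (fun ω =>
        (f (BoxUnionPair.status ends {u, v} s t ω).1
              (OrderDual.ofDual (BoxUnionPair.status ends {u, v} s t ω).2) -
            BoxUnionPair.condMean p ends {u, v} s t
              (fun k => f k.1 (OrderDual.ofDual k.2))) *
          (g (BoxUnionPair.status ends {u, v} s t ω).1
              (OrderDual.ofDual (BoxUnionPair.status ends {u, v} s t ω).2) -
            BoxUnionPair.condMean p ends {u, v} s t
              (fun k => g k.1 (OrderDual.ofDual k.2))))) := by
  have hZ : total (gridMass ends s t u v p) ≠ 0 := by
    rw [total_gridMass_eq]
    exact hQ.ne'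
  rw [row_eq_rowVal ends s t u v hne f g hX hY hZ]
  refine div_nonneg ?_ (sq_nonneg _)
  refine rowVal_nonneg_of_upsets _ _ (fun A B hA hB => ?_) _ _ (gridFun_mono u v hf)
    (gridFun_mono u v hg)
  rw [rowVal_ind_eq]
  exact sum_term_unionCells_nonneg' ends s t u v hp hU hA hB

end UnionRowCell

end Summit.Ventures.PercRepro2
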